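import Literature.MathematicalPhysics.QuantumFieldTheory.Balaban1983to89.B2Eq350TowerVolume
import Literature.MathematicalPhysics.QuantumFieldTheory.Balaban1983to89.B2Sect3C

/-!
# `Balaban1983to89.B2Eq352TowerVolumeBound` — T. Bałaban, *(Higgs)₂,₃ quantum fields in a finite volume. II. An upper bound*,
Commun. Math. Phys. **86** (1982) 555–594 [Balaban1982Higgs2] pp. 593–594, (3.50)–(3.52): **the radii of the covering of
`Λ₀^{(k)c}` summed over the steps — *"r(L^{k−j}ε) ≦ (1 + j log L)ʳ r(Lᵏε) … ≤ 22^d Σ_{j=0}^∞ L⁻ʲ(1 + j log L)ʳ (r(Lᵏε))^d =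
O(1)(r(Lᵏε))^d"* (3.51) — giving the shape (3.52) `|Λ₀^{(k)c}| ≤ O(1) r(Lᵏε)^d (|𝒞₀| + … + |𝒞_k|)` FOR THE REGIONS CONSTRUCTED
on the concrete (Higgs)₂,₃ tori**, with an explicit `O(1)`

statement-level skeleton of published theorems with citation tags; proofs where landed; nothing here is a claim about the Yang–Mills mass gap

PDF held: `paper:balaban1982-cmp86-higgs23-ii` (journal page = PDF page + 554); pp. 593–594 [PDF 39–40] (p. 593 READ AS AN
IMAGE on the ×2 render `run/shared/lean/pub/pub-balaban/b2b-balaban-ref1/pages/1982-cmp86-higgs23-II/…-p039-x2.png`; (3.51)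
through r14's kernel-checked transcription in `B2Sect3C`).

CITATION HEADER (lean-in-tree rule).  lit-balaban typed skeleton (HOME `run/shared/lean/pub/lit-balaban/`), typer line
(concrete carriers), gen 9, sequel of `B2Eq350TowerVolume`.  SKELETON rows served: **B2.Eq3.47** (members (3.50)–(3.52);
owner r02, second reader r14 — r14's `B2Sect3C.Bound352 P ρ X D` is the SHAPE `|Λ₀⁽ᵏ⁾ᶜ| ≤ D r(Lᵏε)ᵈ (|𝒞₀| + … + |𝒞_k|)` over
abstract data; this file proves that shape, with an explicit `D`, for the constructed tower with `|𝒞_l|` read as the number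
of large-field points of step `l + 1`), B2.Eq3.42 (r14's `claim342_of_leaves`/p23's (3.46) ⇒ (3.47) take (3.52) as a leaf).
NOTHING of record is restated: the series `Σ_j L⁻ʲ(1 + j log L)ʳ` and its bounds ARE r14's `B2Sect3C.term351/S351/
sum_le_S351/one_le_S351`, `r(ε)` IS `B2.rFn`; r14's `r_rescale_le` is the `Run`-indexed twin of `rFn_rescale_le` below (same
three-line argument, stated here on the bare sequence `m ↦ r(Lᵐε)` because the tower carries no `B2.Run`).

THE SOURCE TEXT, pp. 593–594, verbatim.  (3.50): *"|Λ₀^{(k)c}| ≦ (L^{−k}22r(ε) + L^{−(k−1)}20r(Lε) + … + L⁻¹20r(L^{k−1}ε))^d|𝒞₀|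
+ … + (2r(Lᵏε))^d|𝒞_k|."*  p. 594: *"The expression on the right sides of the above inequalities can be simplified. Thus
r(L^{k−j}ε) ≦ (1 + j log L)ʳ r(Lᵏε) and the factor standing at |𝒞_l| can be estimated by (22r(Lᵏε))^d (L^{−(k−1)}(1 +
(k−1) log L)ʳ + … + L⁻¹(1 + log L)ʳ + 1) ≦ 22^d Σ_{j=0}^∞ L⁻ʲ(1 + j log L)ʳ (r(Lᵏε))^d = O(1)(r(Lᵏε))^d, (3.51) hence
|Λ₀^{(k)c}| ≦ O(1) r(Lᵏε)^d (|𝒞₀| + … + |𝒞_k|). (3.52)"*  (v1.1 DOCFIX of this quotation — second reader r14 g9,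
SECONDREAD-B2 v16, p. 594 re-read as an image: v1 had OUR DERIVATION inside the quotation marks. Not print, but how this
file READS (3.51): r(L^{k−j}ε) = R(1 + log(Lᵏε)⁻¹ + j log L)ʳ ≦ (1 + j log L)ʳ r(Lᵏε) since 1 + log(Lᵏε)⁻¹ ≥ 1 when Lᵏε ≤ 1
(`log_inv_rescale`, `rFn_rescale_le`), and for a general l the bracket is (L^{−(k−l)}(1 + (k−l) log L)ʳ + … + 1) (`corr_le`).)

DICTIONARY (print ↦ Lean).  `r(Lᵐε)` ↦ a sequence `r : ℕ → ℝ` with the (3.51) rescaling property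
`r (k − j) ≤ (1 + j log L)ˢ · r k` as a HYPOTHESIS (`hresc`; discharged for the printed `B2.rFn R s (Lᵐε)` by `rFn_rescale_le`
when `Lᵏε ≤ 1`); `Σ_j L⁻ʲ(1 + j log L)ʳ` ↦ `B2Sect3C.S351`; the *"factor standing at |𝒞_l|"* ↦ `rad P r k l i`
(`B2Eq350TowerVolume`), summed through the corridor sums `corr`; `O(1)` ↦ `coef352 P S i = 4·max(i+1, 8)·S·LM + 1`.

WHAT THIS FILE PROVES (0 sorry; standard axioms).
§1 `corr P r l m` (the rescaled corridor sums `Σ_{j ≤ m−l} (r_{m−j} + 2LM − 1)/Lʲ`), `corr_self`, `corr_succ`, **`rad_seven_le_corr`**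
   (`rad r m l 7 ≤ 8·corr`), **`rad_le_corr`** (`rad r k l i ≤ max(i+1,8)·corr`), **`corr_le`** ((3.51): `corr ≤ (r_k + 2LM − 1)·S351`
   under `hresc`), **`rad_le`**.
§2 **`card_compl_towerRegion_le_sum`** (`|Λ_i^{(k)c}| ≤ (2⌊max(i+1,8) S351 (r_k + 2LM − 1)⌋ + 1)^d Σ_{l≤k} |bad_l|`) and the (3.52)
   shape **`card_compl_towerRegion_le_352`** (`|Λ_i^{(k)c}| ≤ (coef352 · r_k)^d Σ_{l≤k} |bad_l|` when `r_k ≥ 1`).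
§3 the printed radii: `rFn_rescale_le` ((3.51) first claim), `one_le_rFn`, **`card_compl_towerRegion_le_352_rFn`**
   (`|Λ_i^{(k)c}| ≤ (coef352 · r(Lᵏε))^d Σ_{l≤k} |bad_l|` for `r_m = R(1 + log(Lᵐε)⁻¹)ˢ`, `R ≥ 1`, `s ≥ 0`, `Lᵏε ≤ 1`, `k ≤ K`).
HONEST SCOPE.  (a) As in `B2Eq350TowerVolume`: large-field POINTS, not the cubes `𝒞_l` (the print's `|𝒞_l| ≤ 3^d(#elements)`);
(b) the `O(1)` is this construction's `(4·max(i+1,8)·S351·LM + 1)^d`, not `(22·S351)^d` (r14's `bound352_of_350`), the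
difference being the print's standing assumption `r(ε) ≫ LM` versus the explicit `LM`-terms kept here; (c) levels `k ≤ K`;
(d) no field, no measure; NOT summit progress.  Unit `lit-balaban-typer` gen 9 (literature-prover-lit-balaban-typer-g9-0);
HOME/FILED.md records the proposal.
-/

open scoped BigOperators

namespace Literature.MathematicalPhysics.QuantumFieldTheory.Balaban1983to89.B2Eq352TowerVolumeBound

open HiggsLattice B2Eq28RegionsConcrete B2Eq243RegionsTower B2Eq350TowerVolume
open B2Sect3C (term351 S351 sum_le_S351 one_le_S351 term351_nonneg)

variable {P : HiggsLattice.Params}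

/-! ## §1 The radii summed along the steps ((3.50)–(3.51)) -/

section Radii

/-- **The rescaled corridor sum** between the steps `l ≤ m`: `Σ_{j=0}^{m−l} (r_{m−j} + 2LM − 1)/Lʲ` — the printed
`L^{−(m−l)}·r(Lˡε) + … + L⁻¹·r(L^{m−1}ε) + ·r(Lᵐε)` pattern of (3.50), with this construction's per-step thickness unit
`r + 2(LM − 1) + 1`. [cite: Balaban1982Higgs2, (3.50) p.593] -/
noncomputable def corr (P : HiggsLattice.Params) (r : ℕ → ℝ) (l m : ℕ) : ℝ :=
  ∑ j ∈ Finset.range (m - l + 1), (r (m - j) + (2 * ((P.L : ℝ) * P.M - 1) + 1)) / (P.L : ℝ) ^ j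

variable {r : ℕ → ℝ}

/-- At its own step the corridor sum is one thickness unit. [cite: Balaban1982Higgs2, (3.48) p.593] -/
theorem corr_self (l : ℕ) : corr P r l l = r l + (2 * ((P.L : ℝ) * P.M - 1) + 1) := by
  unfold corr
  rw [Nat.sub_self, zero_add, Finset.sum_range_one, Nat.sub_zero, pow_zero, div_one]

/-- The recursion of the corridor sums (`l ≤ m`): `corr l (m+1) = (r_{m+1} + 2LM − 1) + corr l m / L` — *"After rescaling … We
add 𝒞₁"*. [cite: Balaban1982Higgs2, (3.49) p.593] -/
theorem corr_succ {l m : ℕ} (hlm : l ≤ m) :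
    corr P r l (m + 1) = (r (m + 1) + (2 * ((P.L : ℝ) * P.M - 1) + 1)) + corr P r l m / (P.L : ℝ) := by
  unfold corr
  rw [show m + 1 - l + 1 = (m - l + 1) + 1 by omega, Finset.sum_range_succ', Nat.sub_zero, pow_zero, div_one, add_comm,
    Finset.sum_div]
  congr 1
  refine Finset.sum_congr rfl fun j hj => ?_
  rw [show m + 1 - (j + 1) = m - j by omega, pow_succ, div_div]

/-- Nonnegativity of the thickness unit's constant part: `2(LM − 1) + 1 ≥ 0`. [cite: Balaban1982Higgs1, (1.17) p.606] -/
theorem two_D_add_one_nonneg (P : HiggsLattice.Params) : 0 ≤ 2 * ((P.L : ℝ) * P.M - 1) + 1 := by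
  have hL : (1 : ℝ) ≤ P.L := by exact_mod_cast P.hL
  have hM : (1 : ℝ) ≤ P.M := by exact_mod_cast P.hM
  nlinarith

/-- `LM − 1 ≥ 0`. [cite: Balaban1982Higgs1, (1.17) p.606] -/
theorem D_nonneg (P : HiggsLattice.Params) : 0 ≤ (P.L : ℝ) * P.M - 1 := by
  have hL : (1 : ℝ) ≤ P.L := by exact_mod_cast P.hL
  have hM : (1 : ℝ) ≤ P.M := by exact_mod_cast P.hM
  nlinarith

/-- The corridor sums are nonnegative for nonnegative radii. [cite: Balaban1982Higgs2, (3.50) p.593] -/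
theorem corr_nonneg {l m : ℕ} (hr : ∀ n, n ≤ m → 0 ≤ r n) : 0 ≤ corr P r l m := by
  unfold corr
  refine Finset.sum_nonneg fun j _ => div_nonneg ?_ (pow_nonneg (Nat.cast_nonneg _) _)
  have := hr (m - j) (Nat.sub_le m j)
  have := two_D_add_one_nonneg P
  linarith

/-- **The `Λ₇`-corridor radii along the steps**: `rad r m l 7 ≤ 8 · corr l m` for `l ≤ m` (induction on the recursion of
`B2Eq350TowerVolume.rad`: `7(r + 2D) + r + D ≤ 8(r + 2D + 1)` at the own step, `7(r + 2D) + D + 1 + (·)/L` above).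
[cite: Balaban1982Higgs2, (3.50) p.593] -/
theorem rad_seven_le_corr {l : ℕ} : ∀ {m : ℕ}, l ≤ m → (∀ n, n ≤ m → 0 ≤ r n) → rad P r m l 7 ≤ 8 * corr P r l m := by
  intro m hlm hr
  induction m, hlm using Nat.le_induction with
  | base =>
      rw [rad_self, corr_self]
      have h0 := hr l le_rfl
      have hD := D_nonneg P
      push_cast
      nlinarith
  | succ m hlm ih =>
      have ih' := ih fun n hn => hr n (Nat.le_succ_of_le hn)
      rw [rad_succ_of_ne (by omega), corr_succ hlm]
      have hL : (0 : ℝ) < P.L := by exact_mod_cast P.hL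
      have h0 := hr (m + 1) le_rfl
      have hD := D_nonneg P
      have hdiv : rad P r m l 7 / (P.L : ℝ) ≤ 8 * corr P r l m / (P.L : ℝ) := div_le_div_of_nonneg_right ih' hL.le
      push_cast
      have : 8 * ((r (m + 1) + (2 * ((P.L : ℝ) * P.M - 1) + 1)) + corr P r l m / (P.L : ℝ))
          = 8 * (r (m + 1) + (2 * ((P.L : ℝ) * P.M - 1) + 1)) + 8 * corr P r l m / (P.L : ℝ) := by ring
      rw [this]
      nlinarith

/-- **Every radius by the corridor sums**: `rad r k l i ≤ max(i+1, 8) · corr l k` for `l ≤ k`. [cite: Balaban1982Higgs2, (3.50) p.593] -/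
theorem rad_le_corr {l k : ℕ} (hlk : l ≤ k) (hr : ∀ n, n ≤ k → 0 ≤ r n) (i : ℕ) :
    rad P r k l i ≤ max ((i : ℝ) + 1) 8 * corr P r l k := by
  have hD := D_nonneg P
  have hE := two_D_add_one_nonneg P
  have hmax1 : (i : ℝ) + 1 ≤ max ((i : ℝ) + 1) 8 := le_max_left _ _
  have hmax8 : (8 : ℝ) ≤ max ((i : ℝ) + 1) 8 := le_max_right _ _
  have hi : (0 : ℝ) ≤ i := Nat.cast_nonneg _
  rcases Nat.eq_or_lt_of_le hlk with rfl | hlt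
  · rw [rad_self, corr_self]
    have h0 := hr l le_rfl
    have hc : 0 ≤ r l + (2 * ((P.L : ℝ) * P.M - 1) + 1) := by linarith
    calc (i : ℝ) * (r l + 2 * ((P.L : ℝ) * P.M - 1)) + r l + ((P.L : ℝ) * P.M - 1)
        ≤ ((i : ℝ) + 1) * (r l + (2 * ((P.L : ℝ) * P.M - 1) + 1)) := by nlinarith
      _ ≤ max ((i : ℝ) + 1) 8 * (r l + (2 * ((P.L : ℝ) * P.M - 1) + 1)) := mul_le_mul_of_nonneg_right hmax1 hc
  · obtain ⟨m, rfl⟩ : ∃ m, k = m + 1 := ⟨k - 1, by omega⟩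
    have hlm : l ≤ m := by omega
    have hL : (0 : ℝ) < P.L := by exact_mod_cast P.hL
    have h7 := rad_seven_le_corr (P := P) hlm fun n hn => hr n (Nat.le_succ_of_le hn)
    have hc0 : 0 ≤ corr P r l m := corr_nonneg fun n hn => hr n (Nat.le_succ_of_le hn)
    have h0 := hr (m + 1) le_rfl
    rw [rad_succ_of_ne (by omega), corr_succ hlm]
    have hdiv : rad P r m l 7 / (P.L : ℝ) ≤ 8 * corr P r l m / (P.L : ℝ) := div_le_div_of_nonneg_right h7 hL.le
    have hq : 0 ≤ corr P r l m / (P.L : ℝ) := div_nonneg hc0 hL.le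
    have hc : 0 ≤ r (m + 1) + (2 * ((P.L : ℝ) * P.M - 1) + 1) := by linarith
    calc (i : ℝ) * (r (m + 1) + 2 * ((P.L : ℝ) * P.M - 1)) + ((P.L : ℝ) * P.M - 1) + rad P r m l 7 / (P.L : ℝ) + 1
        ≤ ((i : ℝ) + 1) * (r (m + 1) + (2 * ((P.L : ℝ) * P.M - 1) + 1)) + 8 * (corr P r l m / (P.L : ℝ)) := by
          rw [mul_div_assoc] at hdiv; nlinarith
      _ ≤ max ((i : ℝ) + 1) 8 * (r (m + 1) + (2 * ((P.L : ℝ) * P.M - 1) + 1))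
            + max ((i : ℝ) + 1) 8 * (corr P r l m / (P.L : ℝ)) :=
          add_le_add (mul_le_mul_of_nonneg_right hmax1 hc) (mul_le_mul_of_nonneg_right hmax8 hq)
      _ = max ((i : ℝ) + 1) 8 * ((r (m + 1) + (2 * ((P.L : ℝ) * P.M - 1) + 1)) + corr P r l m / (P.L : ℝ)) := by ring

/-- **(3.51) for the corridor sums**: if `r_{k−j} ≤ (1 + j log L)ˢ r_k` for `j ≤ k − l` (the printed rescaling property of
`r(Lᵐε)`), then `corr l k ≤ (r_k + 2LM − 1) · Σ_{j≥0} L⁻ʲ(1 + j log L)ˢ` (r14's `S351`). [cite: Balaban1982Higgs2, (3.51) p.594] -/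
theorem corr_le {l k : ℕ} (hL : 1 < (P.L : ℝ)) {s : ℝ} (hs : 0 ≤ s) (hrk : 0 ≤ r k)
    (hresc : ∀ j, j ≤ k - l → r (k - j) ≤ (1 + (j : ℝ) * Real.log (P.L : ℝ)) ^ s * r k) :
    corr P r l k ≤ (r k + (2 * ((P.L : ℝ) * P.M - 1) + 1)) * S351 (P.L : ℝ) s := by
  have hE := two_D_add_one_nonneg P
  have hlog : 0 ≤ Real.log (P.L : ℝ) := Real.log_nonneg hL.le
  have hL0 : (0 : ℝ) < P.L := by linarith
  unfold corr
  calc ∑ j ∈ Finset.range (k - l + 1), (r (k - j) + (2 * ((P.L : ℝ) * P.M - 1) + 1)) / (P.L : ℝ) ^ j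
      ≤ ∑ j ∈ Finset.range (k - l + 1), (r k + (2 * ((P.L : ℝ) * P.M - 1) + 1)) * term351 (P.L : ℝ) s j := by
        refine Finset.sum_le_sum fun j hj => ?_
        have hjk : j ≤ k - l := Nat.lt_succ_iff.mp (Finset.mem_range.mp hj)
        have h1 := hresc j hjk
        have hb : (1 : ℝ) ≤ 1 + (j : ℝ) * Real.log (P.L : ℝ) := by
          have : 0 ≤ (j : ℝ) * Real.log (P.L : ℝ) := by positivity
          linarith
        have hpow : (1 : ℝ) ≤ (1 + (j : ℝ) * Real.log (P.L : ℝ)) ^ s := by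
          have := Real.rpow_le_rpow zero_le_one hb hs
          rwa [Real.one_rpow] at this
        have hnum : r (k - j) + (2 * ((P.L : ℝ) * P.M - 1) + 1)
            ≤ (r k + (2 * ((P.L : ℝ) * P.M - 1) + 1)) * (1 + (j : ℝ) * Real.log (P.L : ℝ)) ^ s := by
          nlinarith
        have hpj : (0 : ℝ) < (P.L : ℝ) ^ j := pow_pos hL0 j
        unfold term351
        rw [div_eq_mul_inv, ← inv_pow]
        calc (r (k - j) + (2 * ((P.L : ℝ) * P.M - 1) + 1)) * ((P.L : ℝ)⁻¹) ^ j
            ≤ ((r k + (2 * ((P.L : ℝ) * P.M - 1) + 1)) * (1 + (j : ℝ) * Real.log (P.L : ℝ)) ^ s) * ((P.L : ℝ)⁻¹) ^ j :=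
              mul_le_mul_of_nonneg_right hnum (pow_nonneg (inv_nonneg.mpr hL0.le) _)
          _ = (r k + (2 * ((P.L : ℝ) * P.M - 1) + 1)) * (((P.L : ℝ)⁻¹) ^ j * (1 + (j : ℝ) * Real.log (P.L : ℝ)) ^ s) := by
              ring
    _ = (r k + (2 * ((P.L : ℝ) * P.M - 1) + 1)) * ∑ j ∈ Finset.range (k - l + 1), term351 (P.L : ℝ) s j := by
        rw [Finset.mul_sum]
    _ ≤ (r k + (2 * ((P.L : ℝ) * P.M - 1) + 1)) * S351 (P.L : ℝ) s :=
        mul_le_mul_of_nonneg_left (sum_le_S351 hL _) (by linarith)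

/-- **The covering radii are `O(1)·r(Lᵏε)`**: `rad r k l i ≤ max(i+1, 8) · S351 · (r_k + 2LM − 1)`, `l ≤ k`, for a nonnegative
radius sequence with the (3.51) rescaling property. [cite: Balaban1982Higgs2, (3.51) p.594] -/
theorem rad_le {l k : ℕ} (hlk : l ≤ k) (hL : 1 < (P.L : ℝ)) {s : ℝ} (hs : 0 ≤ s) (hr : ∀ n, n ≤ k → 0 ≤ r n)
    (hresc : ∀ j, j ≤ k → r (k - j) ≤ (1 + (j : ℝ) * Real.log (P.L : ℝ)) ^ s * r k) (i : ℕ) :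
    rad P r k l i ≤ max ((i : ℝ) + 1) 8 * S351 (P.L : ℝ) s * (r k + (2 * ((P.L : ℝ) * P.M - 1) + 1)) := by
  have h1 := rad_le_corr (P := P) hlk hr i
  have h2 := corr_le (P := P) (l := l) hL hs (hr k le_rfl) fun j hj => hresc j (le_trans hj (Nat.sub_le k l))
  have hm : 0 ≤ max ((i : ℝ) + 1) 8 := le_trans (by norm_num) (le_max_right _ _)
  calc rad P r k l i ≤ max ((i : ℝ) + 1) 8 * corr P r l k := h1
    _ ≤ max ((i : ℝ) + 1) 8 * ((r k + (2 * ((P.L : ℝ) * P.M - 1) + 1)) * S351 (P.L : ℝ) s) :=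
        mul_le_mul_of_nonneg_left h2 hm
    _ = _ := by ring

end Radii

/-! ## §2 (3.52) for the constructed regions: `|Λ_i^{(k)c}| ≤ O(1) r_k^d (|bad_0| + … + |bad_k|)` -/

section Bound

variable {bad : (j : ℕ) → Finset (HiggsLattice.Site P j)} {r : ℕ → ℝ}

/-- **All steps with one radius**: `|Λ_i^{(k)c}| ≤ (2⌊max(i+1,8)·S351·(r_k + 2LM − 1)⌋ + 1)^d · Σ_{l ≤ k} |bad_l|` (`k ≤ K`).
[cite: Balaban1982Higgs2, (3.52) p.594] -/
theorem card_compl_towerRegion_le_sum {k : ℕ} (hk : k ≤ P.K) (hL : 1 < (P.L : ℝ)) {s : ℝ} (hs : 0 ≤ s)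
    (hr : ∀ n, n ≤ k → 0 ≤ r n) (hresc : ∀ j, j ≤ k → r (k - j) ≤ (1 + (j : ℝ) * Real.log (P.L : ℝ)) ^ s * r k) (i : ℕ) :
    (((towerRegionF bad r k i)ᶜ).card : ℝ) ≤
      (2 * ⌊max ((i : ℝ) + 1) 8 * S351 (P.L : ℝ) s * (r k + (2 * ((P.L : ℝ) * P.M - 1) + 1))⌋₊ + 1 : ℕ) ^ P.d
        * ∑ l ∈ Finset.range (k + 1), ((bad l).card : ℝ) := by
  have h := card_compl_towerRegion_le (bad := bad) (r := r) hk i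
  have hmono : ∀ l ∈ Finset.range (k + 1),
      (bad l).card * (2 * ⌊rad P r k l i⌋₊ + 1) ^ P.d ≤
        (bad l).card * (2 * ⌊max ((i : ℝ) + 1) 8 * S351 (P.L : ℝ) s * (r k + (2 * ((P.L : ℝ) * P.M - 1) + 1))⌋₊ + 1) ^ P.d := by
    intro l hl
    have hlk : l ≤ k := Nat.lt_succ_iff.mp (Finset.mem_range.mp hl)
    refine Nat.mul_le_mul_left _ (Nat.pow_le_pow_left ?_ _)
    have := Nat.floor_le_floor (rad_le (P := P) hlk hL hs hr hresc i)
    omega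
  have h2 := h.trans (Finset.sum_le_sum hmono)
  rw [← Finset.sum_mul] at h2
  have h3 := (Nat.cast_le (α := ℝ)).mpr h2
  rw [Nat.cast_mul, Nat.cast_pow, Nat.cast_sum, mul_comm] at h3
  exact_mod_cast h3

/-- **The `O(1)` of (3.52) for this construction**: `coef352 P S i = 4·max(i+1, 8)·S·LM + 1` (with `S = S351`).
[cite: Balaban1982Higgs2, (3.52) p.594] -/
noncomputable def coef352 (P : HiggsLattice.Params) (S : ℝ) (i : ℕ) : ℝ :=
  4 * max ((i : ℝ) + 1) 8 * S * ((P.L : ℝ) * P.M) + 1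

/-- Absorbing the constants when `r_k ≥ 1`: `2⌊max·S·(r_k + 2LM − 1)⌋ + 1 ≤ coef352 · r_k`. [cite: Balaban1982Higgs2, (3.52) p.594] -/
theorem two_floor_add_one_le {S : ℝ} (hS : 1 ≤ S) {x : ℝ} (hx : 1 ≤ x) (i : ℕ) :
    ((2 * ⌊max ((i : ℝ) + 1) 8 * S * (x + (2 * ((P.L : ℝ) * P.M - 1) + 1))⌋₊ + 1 : ℕ) : ℝ) ≤ coef352 P S i * x := by
  have hD := D_nonneg P
  have hm8 : (8 : ℝ) ≤ max ((i : ℝ) + 1) 8 := le_max_right _ _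
  have hm0 : 0 ≤ max ((i : ℝ) + 1) 8 := by linarith
  have hLM : (1 : ℝ) ≤ (P.L : ℝ) * P.M := by linarith
  have hy : 0 ≤ max ((i : ℝ) + 1) 8 * S * (x + (2 * ((P.L : ℝ) * P.M - 1) + 1)) := by
    have : 0 ≤ x + (2 * ((P.L : ℝ) * P.M - 1) + 1) := by linarith
    have : 0 ≤ max ((i : ℝ) + 1) 8 * S := by nlinarith
    positivity
  have hfl := Nat.floor_le hy
  push_cast
  unfold coef352
  -- x + 2LM − 1 ≤ 2LM·x for x ≥ 1
  have hx2 : x + (2 * ((P.L : ℝ) * P.M - 1) + 1) ≤ 2 * ((P.L : ℝ) * P.M) * x := by nlinarith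
  have hmS : 0 ≤ max ((i : ℝ) + 1) 8 * S := by nlinarith
  nlinarith [mul_le_mul_of_nonneg_left hx2 hmS]

/-- **(3.52) for the regions CONSTRUCTED from the large-field points**: `|Λ_i^{(k)c}| ≤ (coef352 · r_k)^d · (|bad_0| + … + |bad_k|)`
for `k ≤ K`, `L ≥ 2`, a nonnegative radius sequence with `r_k ≥ 1` and the (3.51) rescaling property with exponent `s ≥ 0`.
[cite: Balaban1982Higgs2, (3.52) p.594] -/
theorem card_compl_towerRegion_le_352 {k : ℕ} (hk : k ≤ P.K) (hL : 1 < (P.L : ℝ)) {s : ℝ} (hs : 0 ≤ s)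
    (hr : ∀ n, n ≤ k → 0 ≤ r n) (hrk : 1 ≤ r k)
    (hresc : ∀ j, j ≤ k → r (k - j) ≤ (1 + (j : ℝ) * Real.log (P.L : ℝ)) ^ s * r k) (i : ℕ) :
    (((towerRegionF bad r k i)ᶜ).card : ℝ) ≤
      (coef352 P (S351 (P.L : ℝ) s) i * r k) ^ P.d * ∑ l ∈ Finset.range (k + 1), ((bad l).card : ℝ) := by
  refine (card_compl_towerRegion_le_sum hk hL hs hr hresc i).trans ?_
  have hsum : 0 ≤ ∑ l ∈ Finset.range (k + 1), ((bad l).card : ℝ) := Finset.sum_nonneg fun _ _ => Nat.cast_nonneg _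
  refine mul_le_mul_of_nonneg_right ?_ hsum
  have h1 := two_floor_add_one_le (P := P) (one_le_S351 (r := s) hL) hrk i
  have h0 : (0 : ℝ) ≤ ((2 * ⌊max ((i : ℝ) + 1) 8 * S351 (P.L : ℝ) s * (r k + (2 * ((P.L : ℝ) * P.M - 1) + 1))⌋₊ + 1 : ℕ) : ℝ) :=
    Nat.cast_nonneg _
  have := pow_le_pow_left₀ h0 h1 P.d
  exact_mod_cast this

end Bound

/-! ## §3 The printed radii `r(Lᵐε) = R(1 + log(Lᵐε)⁻¹)ˢ` -/

section Printed

/-- `1 + log(Lᵏε)⁻¹ ≥ 1` when `Lᵏε ≤ 1`. [cite: Balaban1982Higgs2, (3.51) p.594] -/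
theorem one_le_xk {L ε : ℝ} (hL : 0 < L) (hε : 0 < ε) {k : ℕ} (hk : L ^ k * ε ≤ 1) : 1 ≤ 1 + Real.log (L ^ k * ε)⁻¹ := by
  have hpos : 0 < L ^ k * ε := by positivity
  have : 0 ≤ Real.log (L ^ k * ε)⁻¹ := Real.log_nonneg ((one_le_inv₀ hpos).mpr hk)
  linarith

/-- `log(L^{k−j}ε)⁻¹ = log(Lᵏε)⁻¹ + j log L` (`j ≤ k`). [cite: Balaban1982Higgs2, (3.51) p.594] -/
theorem log_inv_rescale {L ε : ℝ} (hL : 0 < L) (hε : 0 < ε) {j k : ℕ} (hjk : j ≤ k) :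
    Real.log (L ^ (k - j) * ε)⁻¹ = Real.log (L ^ k * ε)⁻¹ + j * Real.log L := by
  have hLj : L ^ j ≠ 0 := by positivity
  have hLkj : L ^ (k - j) ≠ 0 := by positivity
  have hsplit : L ^ k = L ^ (k - j) * L ^ j := by rw [← pow_add, Nat.sub_add_cancel hjk]
  have e1 : Real.log (L ^ (k - j) * ε) = Real.log (L ^ (k - j)) + Real.log ε := Real.log_mul hLkj hε.ne'
  have e2 : Real.log (L ^ k * ε) = Real.log (L ^ (k - j)) + Real.log (L ^ j) + Real.log ε := by
    rw [hsplit, Real.log_mul (by positivity) hε.ne', Real.log_mul hLkj hLj]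
  rw [Real.log_inv, Real.log_inv, e1, e2, Real.log_pow, Real.log_pow]
  ring

/-- **(3.51), first claim**: *"r(L^{k−j}ε) = R(1 + log(Lᵏε)⁻¹ + j log L)ʳ ≦ (1 + j log L)ʳ r(Lᵏε)"* for `j ≤ k`, `Lᵏε ≤ 1`,
`L ≥ 1`, `R ≥ 0`, exponent `s ≥ 0` (r14's `B2Sect3C.r_rescale_le` is the `Run`-indexed form of the same computation).
[cite: Balaban1982Higgs2, (3.51) p.594] -/
theorem rFn_rescale_le {L ε R s : ℝ} (hL : 1 ≤ L) (hε : 0 < ε) (hR : 0 ≤ R) (hs : 0 ≤ s) {j k : ℕ} (hjk : j ≤ k)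
    (hk : L ^ k * ε ≤ 1) :
    B2.rFn R s (L ^ (k - j) * ε) ≤ (1 + (j : ℝ) * Real.log L) ^ s * B2.rFn R s (L ^ k * ε) := by
  have hL0 : 0 < L := by linarith
  have hx1 := one_le_xk hL0 hε hk
  have hlog : 0 ≤ Real.log L := Real.log_nonneg hL
  have hjl : 0 ≤ (j : ℝ) * Real.log L := by positivity
  unfold B2.rFn
  rw [log_inv_rescale hL0 hε hjk]
  set x := 1 + Real.log (L ^ k * ε)⁻¹ with hx
  have hle : x + (j : ℝ) * Real.log L ≤ (1 + (j : ℝ) * Real.log L) * x := by nlinarith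
  have h0 : 0 ≤ x + (j : ℝ) * Real.log L := by linarith
  have h1 : (x + (j : ℝ) * Real.log L) ^ s ≤ ((1 + (j : ℝ) * Real.log L) * x) ^ s := Real.rpow_le_rpow h0 hle hs
  rw [Real.mul_rpow (by linarith) (by linarith)] at h1
  have : (1 : ℝ) + (Real.log (L ^ k * ε)⁻¹ + (j : ℝ) * Real.log L) = x + (j : ℝ) * Real.log L := by rw [hx]; ring
  rw [this]
  calc R * (x + (j : ℝ) * Real.log L) ^ s ≤ R * ((1 + (j : ℝ) * Real.log L) ^ s * x ^ s) :=
        mul_le_mul_of_nonneg_left h1 hR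
    _ = (1 + (j : ℝ) * Real.log L) ^ s * (R * x ^ s) := by ring

/-- `r(Lᵏε) ≥ R ≥ 1` when `Lᵏε ≤ 1` ((2.7): *"R > R₀"*; here `R ≥ 1`). [cite: Balaban1982Higgs2, (2.7) p.558] -/
theorem one_le_rFn {L ε R s : ℝ} (hL : 0 < L) (hε : 0 < ε) (hR : 1 ≤ R) (hs : 0 ≤ s) {k : ℕ} (hk : L ^ k * ε ≤ 1) :
    1 ≤ B2.rFn R s (L ^ k * ε) := by
  have hx1 := one_le_xk hL hε hk
  unfold B2.rFn
  have : (1 : ℝ) ≤ (1 + Real.log (L ^ k * ε)⁻¹) ^ s := by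
    have := Real.rpow_le_rpow zero_le_one hx1 hs
    rwa [Real.one_rpow] at this
  nlinarith

/-- `r(Lᵐε) ≥ 0`. [cite: Balaban1982Higgs2, (2.7) p.558] -/
theorem rFn_nonneg {L ε R s : ℝ} (hL : 0 < L) (hε : 0 < ε) (hR : 0 ≤ R) (m : ℕ) (hm : L ^ m * ε ≤ 1) :
    0 ≤ B2.rFn R s (L ^ m * ε) := by
  unfold B2.rFn
  exact mul_nonneg hR (Real.rpow_nonneg (by have := one_le_xk hL hε hm; linarith) _)

variable {bad : (j : ℕ) → Finset (HiggsLattice.Site P j)}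

/-- **(3.52) with the printed radii** `r_m = r(Lᵐε) = R(1 + log(Lᵐε)⁻¹)ˢ` (`B2.rFn`; in lattice units of `T₁^{(m)}`): for
`k ≤ K`, `Lᵏε ≤ 1`, `L ≥ 2`, `R ≥ 1`, `s ≥ 0`,
`|Λ_i^{(k)c}| ≤ (coef352 · r(Lᵏε))^d · (|bad_0| + … + |bad_k|)`. [cite: Balaban1982Higgs2, (3.52) p.594] -/
theorem card_compl_towerRegion_le_352_rFn {ε R s : ℝ} (hε : 0 < ε) (hR : 1 ≤ R) (hs : 0 ≤ s) (hL : 1 < (P.L : ℝ))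
    {k : ℕ} (hk : k ≤ P.K) (hkε : (P.L : ℝ) ^ k * ε ≤ 1) (i : ℕ) :
    (((towerRegionF bad (fun m => B2.rFn R s ((P.L : ℝ) ^ m * ε)) k i)ᶜ).card : ℝ) ≤
      (coef352 P (S351 (P.L : ℝ) s) i * B2.rFn R s ((P.L : ℝ) ^ k * ε)) ^ P.d
        * ∑ l ∈ Finset.range (k + 1), ((bad l).card : ℝ) := by
  have hL0 : (0 : ℝ) < P.L := by linarith
  have hmono : ∀ n, n ≤ k → (P.L : ℝ) ^ n * ε ≤ 1 := fun n hn =>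
    le_trans (mul_le_mul_of_nonneg_right (pow_le_pow_right₀ hL.le hn) hε.le) hkε
  refine card_compl_towerRegion_le_352 hk hL hs (fun n hn => rFn_nonneg hL0 hε (by linarith) n (hmono n hn))
    (one_le_rFn hL0 hε hR hs hkε) (fun j hj => rFn_rescale_le hL.le hε (by linarith) hs hj hkε) i

end Printed

end Literature.MathematicalPhysics.QuantumFieldTheory.Balaban1983to89.B2Eq352TowerVolumeBound
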